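import Summits.QuantumFields.YangMills.Theorems.AllWindowsColdBoxBoxHighLineGhostTraceZero
import Summits.QuantumFields.YangMills.Theorems.AllWindowsColdBoxBoxHighLineBoxStateEdgeChart
import Summits.QuantumFields.YangMills.Theorems.AllWindowsColdBoxBoxHighLineEdgeChartSupport
import Summits.QuantumFields.YangMills.Theorems.AllWindowsColdBoxBoxHighLineStep2Wick
import Summits.QuantumFields.YangMills.Theorems.AllWindowsColdBoxBoxHighLineSkinCoercivity

/-!
# T-S5.7d input: the GHOST QUADRATIC FORM `M_H` of the edge chart and the exact identity `quadVal M_H a = tr X_B(a) − ½ tr X_A(a)²`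
# (STUB-PLAN-S5-STEP2 §8, planner ym-idea-2 g18 routing 2026-08-29T19:46:09Z (iii) `GhostTaylor`; LINE-19 S5 ⟨stmt-QuantumFields-24004⟩/⟨24335⟩)

Width seat `ym-line-sfw-p2-w3` (g40).  In the edge chart every link is `↑(e^{i a_e}) = 1 + X(a_e) − (‖a_e‖²/2)·1 + R(a_e)` (✓`GhostFP.coe_expPauli_sub_eq`),
so the Faddeev–Popov perturbation is `F(U(a)) − F₁ = A(a) + B(a) + R(a)` with `A(a) = fpGen (chartL a)` LINEAR in `a`, `B(a) = fpGen (chartQ a)`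
QUADRATIC, `R(a) = fpGen (chartR a)` cubic (`fpOperator_edgeChart_sub_one`).  The quadratic part of `log|det(1 + F₁⁻¹(A+B+R))|` is
`tr F₁⁻¹B(a) − ½ tr (F₁⁻¹A(a))²` (the linear term `tr F₁⁻¹A(a)` vanishes, ✓`GhostFP.trace_ghostX_su2Coord`).  This file types its matrix:

* basis link fields `basisLinkL H i = X(e_c)` on the single edge `e` (`i = (e, c)`), `basisLinkQ H e = 1` on the edge `e`; on the cold-box links
  `chartL a = Σ_i a_i · basisLinkL i`, `chartQ a = Σ_i (−a_i²/2) · basisLinkQ i.1` (`chartL_eq_sum`, `chartQ_eq_sum`);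
* **`GhostFP.ghostM H`**`: Matrix (LandauFree H × Fin 3) (LandauFree H × Fin 3) ℝ`, `M_{ij} = −½ tr(X_i X_j) − ½[i = j] tr Y_{i.1}` with
  `X_i = ghostX (basisLinkL i)`, `Y_e = ghostX (basisLinkQ e)`;
* ★ **`quadVal_ghostM : quadVal (ghostM H) a = tr (ghostX (chartQ a)) − ½ tr (ghostX (chartL a) · ghostX (chartL a))`** and
  `trace_ghostX_chartL : tr (ghostX (chartL a)) = 0`.

Everything proved; six bookkeeping definitions; standard axioms.  HONEST LABEL: an input of ONE brick (7d) of STEP 2 of the XL stub S5 of a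
critic-PASSed DRAFT line; 7d, S5, U5, ⟨24004⟩ ⟨24335⟩ ⟨24336⟩ remain OPEN; no crux, rung or summit is proved; **the Yang–Mills mass gap is NOT
proved by this file.**
-/

set_option autoImplicit false

noncomputable section

open Matrix Finset
open scoped Matrix.Norms.Operator
open Literature.MathematicalPhysics.QuantumFieldTheory.Balaban1983to89.B10Eq18SigmaSU2 (su2Coord)
open Literature.MathematicalPhysics.QuantumFieldTheory.Balaban1983to89.B10Eq18SigmaSU2Haar (expPauli)
open Literature.MathematicalPhysics.QuantumFieldTheory.AxialGauge (boxEdges)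
open Literature.MathematicalPhysics.QuantumLattice (LGConfig ZdEdge)
open Literature.Probability.LatticeModels (Site)

namespace Summit.QuantumFields.YangMills.Theorems.AllWindowsColdBoxBoxHighLine

namespace GhostFP

variable {H : ℕ}

/-! ## Link fields supported on one edge; the chart link fields -/

/-- The link field equal to `M` on the edge `e₀` and `0` elsewhere. -/
def edgeMat (e₀ : ZdEdge 4) (M : Matrix (Fin 2) (Fin 2) ℂ) : ZdEdge 4 → Matrix (Fin 2) (Fin 2) ℂ := fun e => if e = e₀ then M else 0

/-- The basis link field of the chart coordinate `i = (e, c)`: `X(e_c)` on the edge `e`. -/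
def basisLinkL (H : ℕ) (i : LandauFree H × Fin 3) : ZdEdge 4 → Matrix (Fin 2) (Fin 2) ℂ :=
  edgeMat i.1.1.1 (su2Coord (Pi.single i.2 (1 : ℝ)))

/-- The scalar basis link field of the free edge `e`: `1` on `e`. -/
def basisLinkQ (H : ℕ) (e : LandauFree H) : ZdEdge 4 → Matrix (Fin 2) (Fin 2) ℂ := edgeMat e.1.1 1

/-- The LINEAR part of the chart links: `X(a_e)`. -/
def chartL (H : ℕ) (a : LandauFree H → E3) : ZdEdge 4 → Matrix (Fin 2) (Fin 2) ℂ := fun e => su2Coord (WithLp.ofLp (freeVec H a e))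

/-- The QUADRATIC (scalar) part of the chart links: `−(‖a_e‖²/2)·1`. -/
def chartQ (H : ℕ) (a : LandauFree H → E3) : ZdEdge 4 → Matrix (Fin 2) (Fin 2) ℂ :=
  fun e => ((-(‖freeVec H a e‖ ^ 2 / 2) : ℝ)) • (1 : Matrix (Fin 2) (Fin 2) ℂ)

/-- The CUBIC remainder of the chart links. -/
def chartR (H : ℕ) (a : LandauFree H → E3) : ZdEdge 4 → Matrix (Fin 2) (Fin 2) ℂ := fun e =>
  (((Real.cos ‖freeVec H a e‖ - 1 + ‖freeVec H a e‖ ^ 2 / 2 : ℝ) : ℂ) • (1 : Matrix (Fin 2) (Fin 2) ℂ) +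
    ((Real.sinc ‖freeVec H a e‖ - 1 : ℝ) : ℂ) • su2Coord (WithLp.ofLp (freeVec H a e)))

/-- **The ghost quadratic form** `M_{ij} = −½ tr(X_i X_j) − ½ [i = j] tr Y_{i.1}`. -/
def ghostM (H : ℕ) : Matrix (LandauFree H × Fin 3) (LandauFree H × Fin 3) ℝ :=
  Matrix.of fun i j => -(1 / 2) * (ghostX H (basisLinkL H i) * ghostX H (basisLinkL H j)).trace -
    (if i = j then 1 / 2 * (ghostX H (basisLinkQ H i.1)).trace else 0)

/-- Entries of `ghostM`. -/
theorem ghostM_apply (i j : LandauFree H × Fin 3) :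
    ghostM H i j = -(1 / 2) * (ghostX H (basisLinkL H i) * ghostX H (basisLinkL H j)).trace -
      (if i = j then 1 / 2 * (ghostX H (basisLinkQ H i.1)).trace else 0) := rfl

/-! ## The perturbation of the Faddeev–Popov operator in the chart -/

/-- The chart links minus the identity, split. -/
theorem coe_edgeChart_sub_one (a : LandauFree H → E3) :
    (fun e => ((edgeChart H a e : SU2) : Matrix (Fin 2) (Fin 2) ℂ) - 1) = chartL H a + chartQ H a + chartR H a := by
  funext e
  simp only [Pi.add_apply, chartL, chartQ, chartR, edgeChart]
  exact coe_expPauli_sub_eq (freeVec H a e)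

/-- **`F(U(a)) − F₁ = fpGen (chartL a) + fpGen (chartQ a) + fpGen (chartR a)`.** -/
theorem fpOperator_edgeChart_sub_one (a : LandauFree H → E3) :
    fpOperator H (edgeChart H a) - fpOperator H 1 = fpGen H (chartL H a) + fpGen H (chartQ H a) + fpGen H (chartR H a) := by
  rw [fpOperator_eq_fpGen, fpOperator_eq_fpGen, ← fpGen_sub, ← fpGen_add, ← fpGen_add, ← coe_edgeChart_sub_one]
  rfl

/-- `ghostX` only sees the cold-box links. -/
theorem ghostX_congr {W W' : ZdEdge 4 → Matrix (Fin 2) (Fin 2) ℂ} (h : ∀ e ∈ boxEdges 4 (2 * H + 1), W e = W' e) :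
    ghostX H W = ghostX H W' := by
  rw [ghostX, ghostX, fpGen_congr h]

/-! ## The chart link fields in the basis -/

/-- A box edge as a free variable. -/
theorem exists_free_of_mem_boxEdges {e : ZdEdge 4} (he : e ∈ boxEdges 4 (2 * H + 1)) : ∃ f : LandauFree H, f.1.1 = e :=
  ⟨EdgeChart.freeEquiv H ⟨e, he⟩, rfl⟩

/-- `su2Coord v = Σ_c v_c · X(e_c)`. -/
theorem su2Coord_eq_sum_single (v : Fin 3 → ℝ) : su2Coord v = ∑ c : Fin 3, v c • su2Coord (Pi.single c (1 : ℝ)) := by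
  ext i j
  fin_cases i <;> fin_cases j <;> simp [su2Coord, Fin.sum_univ_three, Matrix.sum_apply, mul_comm, sub_eq_add_neg]

/-- **On the cold-box links `chartL a = Σ_i a_i · basisLinkL i`.** -/
theorem chartL_eq_sum (a : LandauFree H → E3) :
    ∀ e ∈ boxEdges 4 (2 * H + 1), chartL H a e = (∑ i : LandauFree H × Fin 3, (a i.1 i.2) • basisLinkL H i) e := by
  intro e he
  obtain ⟨f, rfl⟩ := exists_free_of_mem_boxEdges he
  rw [chartL, EdgeChart.freeVec_apply_free, Finset.sum_apply, Fintype.sum_prod_type, su2Coord_eq_sum_single]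
  rw [Finset.sum_eq_single f]
  · refine Finset.sum_congr rfl fun c _ => ?_
    simp [basisLinkL, edgeMat]
  · intro g _ hg
    refine Finset.sum_eq_zero fun c _ => ?_
    have : f.1.1 ≠ g.1.1 := fun h => hg (free_ext h).symm
    simp [basisLinkL, edgeMat, this]
  · intro h; exact absurd (Finset.mem_univ f) h

/-- **On the cold-box links `chartQ a = Σ_i (−a_i²/2) · basisLinkQ i.1`.** -/
theorem chartQ_eq_sum (a : LandauFree H → E3) :
    ∀ e ∈ boxEdges 4 (2 * H + 1), chartQ H a e = (∑ i : LandauFree H × Fin 3, (-(a i.1 i.2 ^ 2 / 2)) • basisLinkQ H i.1) e := by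
  intro e he
  obtain ⟨f, rfl⟩ := exists_free_of_mem_boxEdges he
  rw [chartQ, EdgeChart.freeVec_apply_free, Finset.sum_apply, Fintype.sum_prod_type]
  rw [Finset.sum_eq_single f]
  · have hn : ‖a f‖ ^ 2 = ∑ c : Fin 3, a f c ^ 2 := by
      rw [EuclideanSpace.norm_sq_eq]
      exact Finset.sum_congr rfl fun c _ => by rw [Real.norm_eq_abs, sq_abs]
    have h1 : ∀ c : Fin 3, ((-(a f c ^ 2 / 2)) • basisLinkQ H f) f.1.1 = (-(a f c ^ 2 / 2)) • (1 : Matrix (Fin 2) (Fin 2) ℂ) := by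
      intro c; simp [basisLinkQ, edgeMat]
    simp only [h1, ← Finset.sum_smul, hn]
    congr 1
    rw [Finset.sum_div, ← Finset.sum_neg_distrib]
  · intro g _ hg
    refine Finset.sum_eq_zero fun c _ => ?_
    have : f.1.1 ≠ g.1.1 := fun h => hg (free_ext h).symm
    simp [basisLinkQ, edgeMat, this]
  · intro h; exact absurd (Finset.mem_univ f) h

/-- `X_A(a) = Σ_i a_i X_i`. -/
theorem ghostX_chartL (a : LandauFree H → E3) :
    ghostX H (chartL H a) = ∑ i : LandauFree H × Fin 3, (a i.1 i.2) • ghostX H (basisLinkL H i) := by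
  rw [ghostX_congr (chartL_eq_sum a), ghostX_sum]
  exact Finset.sum_congr rfl fun i _ => ghostX_smul _ _

/-- `X_B(a) = Σ_i (−a_i²/2) Y_{i.1}`. -/
theorem ghostX_chartQ (a : LandauFree H → E3) :
    ghostX H (chartQ H a) = ∑ i : LandauFree H × Fin 3, (-(a i.1 i.2 ^ 2 / 2)) • ghostX H (basisLinkQ H i.1) := by
  rw [ghostX_congr (chartQ_eq_sum a), ghostX_sum]
  exact Finset.sum_congr rfl fun i _ => ghostX_smul _ _

/-- **The linear ghost term vanishes**: `tr X_A(a) = 0`. -/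
theorem trace_ghostX_chartL (a : LandauFree H → E3) : (ghostX H (chartL H a)).trace = 0 :=
  trace_ghostX_su2Coord (fun e => WithLp.ofLp (freeVec H a e))

/-! ## The quadratic form identity -/

/-- ★ **`quadVal M_H a = tr X_B(a) − ½ tr (X_A(a)·X_A(a))`.** -/
theorem quadVal_ghostM (a : LandauFree H → E3) :
    quadVal (ghostM H) a = (ghostX H (chartQ H a)).trace - 1 / 2 * (ghostX H (chartL H a) * ghostX H (chartL H a)).trace := by
  -- left-hand side as a double sum
  have hL : quadVal (ghostM H) a = ∑ i : LandauFree H × Fin 3, ∑ j : LandauFree H × Fin 3, a i.1 i.2 * ghostM H i j * a j.1 j.2 := by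
    rw [quadVal, dotProduct]
    refine Finset.sum_congr rfl fun i _ => ?_
    rw [flat, Matrix.mulVec, dotProduct, Finset.mul_sum]
    exact Finset.sum_congr rfl fun j _ => by rw [flat]; ring
  -- right-hand side
  have hQ : (ghostX H (chartQ H a)).trace = ∑ i : LandauFree H × Fin 3, (-(a i.1 i.2 ^ 2 / 2)) * (ghostX H (basisLinkQ H i.1)).trace := by
    rw [ghostX_chartQ, Matrix.trace_sum]
    exact Finset.sum_congr rfl fun i _ => by rw [Matrix.trace_smul, smul_eq_mul]
  have hA : (ghostX H (chartL H a) * ghostX H (chartL H a)).trace =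
      ∑ i : LandauFree H × Fin 3, ∑ j : LandauFree H × Fin 3,
        a i.1 i.2 * a j.1 j.2 * (ghostX H (basisLinkL H i) * ghostX H (basisLinkL H j)).trace := by
    rw [ghostX_chartL, Matrix.sum_mul, Matrix.trace_sum]
    refine Finset.sum_congr rfl fun i _ => ?_
    rw [Matrix.mul_sum, Matrix.trace_sum]
    refine Finset.sum_congr rfl fun j _ => ?_
    rw [Matrix.smul_mul, Matrix.mul_smul, Matrix.trace_smul, Matrix.trace_smul, smul_eq_mul, smul_eq_mul]
    ring
  rw [hL, hQ, hA, Finset.mul_sum, ← Finset.sum_sub_distrib]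
  refine Finset.sum_congr rfl fun i _ => ?_
  rw [Finset.mul_sum]
  have hsplit : ∑ j : LandauFree H × Fin 3, a i.1 i.2 * ghostM H i j * a j.1 j.2 =
      ∑ j : LandauFree H × Fin 3, (a i.1 i.2 * (-(1 / 2) * (ghostX H (basisLinkL H i) * ghostX H (basisLinkL H j)).trace) * a j.1 j.2 -
        (if i = j then a i.1 i.2 * (1 / 2 * (ghostX H (basisLinkQ H i.1)).trace) * a j.1 j.2 else 0)) := by
    refine Finset.sum_congr rfl fun j _ => ?_
    rw [ghostM_apply]
    split_ifs <;> ring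
  rw [hsplit, Finset.sum_sub_distrib, Finset.sum_ite_eq, if_pos (Finset.mem_univ i)]
  have h3 : ∑ j : LandauFree H × Fin 3, a i.1 i.2 * (-(1 / 2) * (ghostX H (basisLinkL H i) * ghostX H (basisLinkL H j)).trace) * a j.1 j.2 =
      -(∑ j : LandauFree H × Fin 3, 1 / 2 * (a i.1 i.2 * a j.1 j.2 * (ghostX H (basisLinkL H i) * ghostX H (basisLinkL H j)).trace)) := by
    rw [← Finset.sum_neg_distrib]
    exact Finset.sum_congr rfl fun j _ => by ring
  rw [h3]
  ring

end GhostFP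

end Summit.QuantumFields.YangMills.Theorems.AllWindowsColdBoxBoxHighLine

end
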